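import Summits.AtomisticToContinuum.FouriersLaw.Theorems.BondHeatUncertaintyBoundedResponseBathHeatC

/-!
# BondHeatUncertainty / BoundedResponse — «BathHeat», part D: §3 the transfer to the total current `V_N ≍ (N−1)²·W_N` up to `O(N³)`
(lens-1 g107 NODE 107 `…BathHeat.lean` sha256 128247e61f0c3dd6…, 1464 l, cut at section boundaries under the 400-line cap by hand-2 g39 for landing: A = §0 (l.1–266),
B = §1 (l.268–492), C = §2 (l.494–617), D = §3 (l.619–867), E = §4 (l.869–1214), main = §5 (l.1216–1462); bodies byte-verbatim, header l.92–107 repeated; full module docstring in part A.) -/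

noncomputable section

open MeasureTheory ProbabilityTheory Filter Topology Set Function
open scoped NNReal ENNReal
open Literature.MathematicalPhysics.KineticTheory.HeatConduction
open Literature.MathematicalPhysics.KineticTheory OscillatorChain
open Literature.Probability.Process
open Summit.AtomisticToContinuum.FouriersLaw.Theorems.SubdiffusiveBondHeat
open Summit.AtomisticToContinuum.FouriersLaw.Theorems.SubdiffusiveBondHeat.EscapeGrading
open Summit.AtomisticToContinuum.FouriersLaw.Theorems.OddSectorIrreversibility

namespace Summit.AtomisticToContinuum.FouriersLaw.Theorems.BoundedResponse.HeatSpreading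

open Summit.AtomisticToContinuum.FouriersLaw.Theorems.BoundedResponse.TransientContact
open Summit.AtomisticToContinuum.FouriersLaw.Theorems.BoundedResponse.ParityFloor (extensiveBlockEnergyVariance_holds)
open Summit.AtomisticToContinuum.FouriersLaw.Theses.BondHeatUncertainty (BoundedResponse SubdiffusiveBondHeat)

/-! ## §3 Transfer to the blocker's total current: `V_N(t) ≍ (N−1)²·W_N(t)` up to `O(N³)`, uniformly in `t` -/

section Transfer

variable {N : ℕ}

/-- `E_{≤0} = e₀ = p₀²/2 + U(q₀) + ½V(q₁ − q₀)` (`N ≥ 2`). [formal bookkeeping] -/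
theorem blockEnergyLeft_zero_eq (P : OscillatorChain) (hN : 1 < N) (x : PhaseSpace N) :
    blockEnergyLeft P N 0 x = x.2 ⟨0, Nat.zero_lt_of_lt hN⟩ ^ 2 / 2 + P.U (x.1 ⟨0, Nat.zero_lt_of_lt hN⟩) +
      P.V (x.1 ⟨1, hN⟩ - x.1 ⟨0, Nat.zero_lt_of_lt hN⟩) / 2 := by
  unfold blockEnergyLeft
  congr 1
  · rw [Finset.sum_eq_single ⟨0, Nat.zero_lt_of_lt hN⟩]
    · simp
    · intro i _ hi
      rw [if_neg]
      intro h
      exact hi (Fin.ext (Nat.le_zero.mp h))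
    · simp
  · rw [Finset.sum_eq_single ⟨0, Nat.zero_lt_of_lt hN⟩]
    · rw [Finset.sum_eq_single ⟨1, hN⟩]
      · simp
      · intro j _ hj
        rw [if_neg]
        intro h
        exact hj (Fin.ext (by simpa using h))
      · simp
    · intro i _ hi
      refine Finset.sum_eq_zero fun j _ => ?_
      have hi' : i.val ≠ 0 := fun h => hi (Fin.ext h)
      by_cases h1 : j.val = i.val + 1
      · rw [if_pos h1, if_neg (by omega), if_neg hi']
      · rw [if_neg h1]
    · simp

/-- The block energies are continuous (for continuous `U, V`). [formal bookkeeping] -/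
theorem continuous_blockEnergyLeft (P : OscillatorChain) (hU : Continuous P.U) (hV : Continuous P.V) (N b : ℕ) :
    Continuous (blockEnergyLeft P N b) := by
  unfold blockEnergyLeft
  refine Continuous.add (continuous_finsetSum _ fun i _ => ?_)
    (continuous_finsetSum _ fun i _ => continuous_finsetSum _ fun j _ => ?_)
  · by_cases h : i.val ≤ b
    · simp only [if_pos h]; fun_prop
    · simp only [if_neg h]; exact continuous_const
  · by_cases h1 : j.val = i.val + 1
    · by_cases h2 : j.val ≤ b
      · simp only [if_pos h1, if_pos h2]; fun_prop
      · by_cases h3 : i.val = b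
        · simp only [if_pos h1, if_neg h2, if_pos h3]; fun_prop
        · simp only [if_pos h1, if_neg h2, if_neg h3]; exact continuous_const
    · simp only [if_neg h1]; exact continuous_const

/-- The centred spread `F̃_b` is continuous. [formal bookkeeping] -/
theorem continuous_leftSpreadCentred (P : OscillatorChain) (hU : Continuous P.U) (hV : Continuous P.V) (T : ℝ)
    (N b : ℕ) : Continuous (leftSpreadCentred P T N b) := by
  unfold leftSpreadCentred
  refine continuous_finsetSum _ fun i _ => ?_
  by_cases h : i.val + 1 < N
  · simp only [if_pos h]
    exact ((continuous_blockEnergyLeft P hU hV N b).sub continuous_const).sub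
      ((continuous_blockEnergyLeft P hU hV N i.val).sub continuous_const)
  · simp only [if_neg h]; exact continuous_const

variable {ω₂ lam β γ : ℝ} (hω : 0 < ω₂) (hl : 0 < lam) (hβ : 0 < β) (hγ : 0 < γ) {T : ℝ} (hT : 0 < T)
include hω hl hβ hγ hT

/-- ★ **TRANSFER: the blocker's variance functional `V_N` and the bath heat variance `W_N` agree at the Fourier scale.**
There is `C` (`= 80·C_W`, `C_W` the constant of the PROVED static input (W) `ExtensiveBlockEnergyVariance`) such that for
all `N ≥ 2` and ALL `t ≥ 0`:
`V_N(t) ≤ 2(N−1)²·W_N(t) + C·N³`  and  `(N−1)²·W_N(t) ≤ 2·V_N(t) + C·N³`.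
Proof: pathwise `∫₀ᵗ J = (N−1)·Q^L_t + G(z_t) − G(z_0)` with the STATIC observable `G = F̃_0 − (N−1)(e₀ − ⟨e₀⟩)`
(total-heat identity of NODE 105 at `b = 0` + the site-`0` energy balance), `∫ G² dμ_T ≤ 10·C_W·N³` by (W), stationarity of
the flow, and `(a+b)² ≤ 2a² + 2b²` twice.  Consequence: at `t = cN²` BOTH are `≍ N⁴` generically and the `O(N³)` error is
one order down, so `HS_h ⟺ W_N(cN²) = O(N^{h−2})` for every `h ≥ 3` (§4). [this cell; new] -/
theorem heatSpread_bathHeatVar_compare :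
    ∃ C : ℝ, ∀ N : ℕ, 1 < N → ∀ t : ℝ, 0 ≤ t →
      heatSpread ω₂ lam β γ T N t ≤ 2 * ((N : ℝ) - 1) ^ 2 * bathHeatVar ω₂ lam β γ T N t + C * (N : ℝ) ^ 3 ∧
      ((N : ℝ) - 1) ^ 2 * bathHeatVar ω₂ lam β γ T N t ≤ 2 * heatSpread ω₂ lam β γ T N t + C * (N : ℝ) ^ 3 := by
  obtain ⟨C_W, hW⟩ := extensiveBlockEnergyVariance_holds ω₂ lam β γ hω hl hβ hγ T hT
  refine ⟨80 * C_W, fun N hN t ht => ?_⟩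
  have hN0 : 0 < N := Nat.zero_lt_of_lt hN
  have hb : 0 + 1 < N := by omega
  haveI := pinnedChain_isProbabilityMeasure_gibbsMeasure hω hl.le hβ.le γ N hT
  have hinv := pinnedChain_hinv_T hω hl hβ hγ hN hT
  have hUc : Continuous (pinnedChain ω₂ lam β γ).U := (pinnedChain_contDiff_U ω₂ lam β γ (n := 0)).continuous
  have hVc : Continuous (pinnedChain ω₂ lam β γ).V := (pinnedChain_contDiff_V ω₂ lam β γ (n := 0)).continuous
  have h0 : ∀ (y : PhaseSpace N) (w' : WienerPair), (pinnedChain ω₂ lam β γ).solMap N T T 0 y w' = y :=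
    fun y w' => pinnedChain_solMap_of_nonpos N T T y w' le_rfl
  have hNR : (1 : ℝ) < N := by exact_mod_cast hN
  -- statics: `F̃_0 ∈ L²`, `∫ F̃_0² ≤ 4 C_W N³`; `e₀ = E_{≤0} ∈ L²`, `Var(e₀) ≤ C_W N`; hence `∫ G² ≤ 10 C_W N³`
  have hF := pinnedChain_integrable_sq_leftSpreadCentred_and_le hω hl hβ hT hW hb
  have hE : MemLp (blockEnergyLeft (pinnedChain ω₂ lam β γ) N 0) 2 ((pinnedChain ω₂ lam β γ).gibbsMeasure N T) :=
    (hW N 0 hb).1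
  have hEv : ∫ y, (blockEnergyLeft (pinnedChain ω₂ lam β γ) N 0 y -
      ∫ y', blockEnergyLeft (pinnedChain ω₂ lam β γ) N 0 y' ∂((pinnedChain ω₂ lam β γ).gibbsMeasure N T)) ^ 2
      ∂((pinnedChain ω₂ lam β γ).gibbsMeasure N T) ≤ C_W * N := by
    have h := (hW N 0 hb).2.2.1
    unfold blockEnergyLeftVar at h
    rwa [variance_eq_integral hE.aestronglyMeasurable.aemeasurable] at h
  have hEc : Integrable (fun y => (blockEnergyLeft (pinnedChain ω₂ lam β γ) N 0 y -
      ∫ y', blockEnergyLeft (pinnedChain ω₂ lam β γ) N 0 y' ∂((pinnedChain ω₂ lam β γ).gibbsMeasure N T)) ^ 2)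
      ((pinnedChain ω₂ lam β γ).gibbsMeasure N T) := (hE.sub (memLp_const _)).integrable_sq
  have hCW : 0 ≤ C_W := by
    have h1 : (0 : ℝ) ≤ C_W * N := (integral_nonneg fun y => sq_nonneg _).trans hEv
    have h2 : (0 : ℝ) < N := by exact_mod_cast hN0
    nlinarith
  have hGm : Measurable (fun y : PhaseSpace N => leftSpreadCentred (pinnedChain ω₂ lam β γ) T N 0 y -
      ((N : ℝ) - 1) * (blockEnergyLeft (pinnedChain ω₂ lam β γ) N 0 y -
        ∫ y', blockEnergyLeft (pinnedChain ω₂ lam β γ) N 0 y' ∂((pinnedChain ω₂ lam β γ).gibbsMeasure N T))) :=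
    ((continuous_leftSpreadCentred _ hUc hVc T N 0).sub (continuous_const.mul
      ((continuous_blockEnergyLeft _ hUc hVc N 0).sub continuous_const))).measurable
  have hG2 : Integrable (fun y : PhaseSpace N => (leftSpreadCentred (pinnedChain ω₂ lam β γ) T N 0 y -
      ((N : ℝ) - 1) * (blockEnergyLeft (pinnedChain ω₂ lam β γ) N 0 y -
        ∫ y', blockEnergyLeft (pinnedChain ω₂ lam β γ) N 0 y' ∂((pinnedChain ω₂ lam β γ).gibbsMeasure N T))) ^ 2)
      ((pinnedChain ω₂ lam β γ).gibbsMeasure N T) := by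
    refine ((hF.1.const_mul 2).add (hEc.const_mul (2 * ((N : ℝ) - 1) ^ 2))).mono' (hGm.pow_const 2).aestronglyMeasurable
      (Eventually.of_forall fun y => ?_)
    rw [Real.norm_eq_abs, abs_of_nonneg (sq_nonneg _)]
    simp only [Pi.add_apply]
    nlinarith [sq_nonneg (leftSpreadCentred (pinnedChain ω₂ lam β γ) T N 0 y +
      ((N : ℝ) - 1) * (blockEnergyLeft (pinnedChain ω₂ lam β γ) N 0 y -
        ∫ y', blockEnergyLeft (pinnedChain ω₂ lam β γ) N 0 y' ∂((pinnedChain ω₂ lam β γ).gibbsMeasure N T)))]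
  have hG2le : ∫ y, (leftSpreadCentred (pinnedChain ω₂ lam β γ) T N 0 y -
      ((N : ℝ) - 1) * (blockEnergyLeft (pinnedChain ω₂ lam β γ) N 0 y -
        ∫ y', blockEnergyLeft (pinnedChain ω₂ lam β γ) N 0 y' ∂((pinnedChain ω₂ lam β γ).gibbsMeasure N T))) ^ 2
      ∂((pinnedChain ω₂ lam β γ).gibbsMeasure N T) ≤ 10 * C_W * (N : ℝ) ^ 3 := by
    have hint : Integrable (fun y => 2 * leftSpreadCentred (pinnedChain ω₂ lam β γ) T N 0 y ^ 2 +
        2 * ((N : ℝ) - 1) ^ 2 * (blockEnergyLeft (pinnedChain ω₂ lam β γ) N 0 y -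
          ∫ y', blockEnergyLeft (pinnedChain ω₂ lam β γ) N 0 y' ∂((pinnedChain ω₂ lam β γ).gibbsMeasure N T)) ^ 2)
        ((pinnedChain ω₂ lam β γ).gibbsMeasure N T) := (hF.1.const_mul 2).add (hEc.const_mul _)
    have h1 := integral_mono_of_nonneg (Eventually.of_forall fun y => sq_nonneg _) hint
      (Eventually.of_forall fun y => (show (leftSpreadCentred (pinnedChain ω₂ lam β γ) T N 0 y -
        ((N : ℝ) - 1) * (blockEnergyLeft (pinnedChain ω₂ lam β γ) N 0 y -
          ∫ y', blockEnergyLeft (pinnedChain ω₂ lam β γ) N 0 y' ∂((pinnedChain ω₂ lam β γ).gibbsMeasure N T))) ^ 2 ≤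
        2 * leftSpreadCentred (pinnedChain ω₂ lam β γ) T N 0 y ^ 2 + 2 * ((N : ℝ) - 1) ^ 2 *
          (blockEnergyLeft (pinnedChain ω₂ lam β γ) N 0 y -
            ∫ y', blockEnergyLeft (pinnedChain ω₂ lam β γ) N 0 y' ∂((pinnedChain ω₂ lam β γ).gibbsMeasure N T)) ^ 2 from by
        nlinarith [sq_nonneg (leftSpreadCentred (pinnedChain ω₂ lam β γ) T N 0 y +
          ((N : ℝ) - 1) * (blockEnergyLeft (pinnedChain ω₂ lam β γ) N 0 y -
            ∫ y', blockEnergyLeft (pinnedChain ω₂ lam β γ) N 0 y' ∂((pinnedChain ω₂ lam β γ).gibbsMeasure N T)))]))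
    have h2 : ∫ y, (2 * leftSpreadCentred (pinnedChain ω₂ lam β γ) T N 0 y ^ 2 +
        2 * ((N : ℝ) - 1) ^ 2 * (blockEnergyLeft (pinnedChain ω₂ lam β γ) N 0 y -
          ∫ y', blockEnergyLeft (pinnedChain ω₂ lam β γ) N 0 y' ∂((pinnedChain ω₂ lam β γ).gibbsMeasure N T)) ^ 2)
        ∂((pinnedChain ω₂ lam β γ).gibbsMeasure N T) =
        2 * (∫ y, leftSpreadCentred (pinnedChain ω₂ lam β γ) T N 0 y ^ 2 ∂((pinnedChain ω₂ lam β γ).gibbsMeasure N T)) +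
        2 * ((N : ℝ) - 1) ^ 2 * ∫ y, (blockEnergyLeft (pinnedChain ω₂ lam β γ) N 0 y -
          ∫ y', blockEnergyLeft (pinnedChain ω₂ lam β γ) N 0 y' ∂((pinnedChain ω₂ lam β γ).gibbsMeasure N T)) ^ 2
          ∂((pinnedChain ω₂ lam β γ).gibbsMeasure N T) := by
      rw [integral_add (hF.1.const_mul 2) (hEc.const_mul _), MeasureTheory.integral_const_mul,
        MeasureTheory.integral_const_mul]
    rw [h2] at h1
    have h3 : ((N : ℝ) - 1) ^ 2 ≤ (N : ℝ) ^ 2 := by nlinarith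
    have hN3 : (0 : ℝ) ≤ C_W * N := mul_nonneg hCW (by positivity)
    nlinarith [hF.2, mul_le_mul_of_nonneg_left hEv (by positivity : (0 : ℝ) ≤ 2 * ((N : ℝ) - 1) ^ 2),
      mul_le_mul_of_nonneg_right h3 hN3]
  -- path level: laws of `G(z_t)`, `G(z_0)`; `L²` of `A = ∫J`, `Q`
  have mGt := pinnedChain_integrable_sq_solMap_of_invariant hω hl.le hβ.le hγ.le N T T _ hinv hG2 t
  have mG0 := pinnedChain_integrable_sq_solMap_of_invariant hω hl.le hβ.le hγ.le N T T _ hinv hG2 0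
  simp only [h0] at mG0
  have hJm := (pinnedChain_continuous_sum_bondCurrent (ω₂ := ω₂) (lam := lam) (β := β) (γ := γ) (N := N)).measurable
  have hJ2 := (pinnedChain_sq_act_sum_bondCurrent hω hl.le hβ hγ hN0 hT 0).1
  have hA2 : Integrable (fun p : PhaseSpace N × WienerPair =>
      (∫ s in (0 : ℝ)..t, (∑ i : Fin N, (pinnedChain ω₂ lam β γ).bondCurrent N i
        ((pinnedChain ω₂ lam β γ).solMap N T T s p.1 (pairPath p.2)))) ^ 2)
      (((pinnedChain ω₂ lam β γ).gibbsMeasure N T).prod wienerPair) := by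
    have h := pinnedChain_integrable_intervalIntegral_mul_of_invariant hω hl.le hβ.le hγ.le N T T _ hinv hJm hJm hJ2 hJ2 ht
    simpa only [sq] using h
  have hp0 : Continuous fun y : PhaseSpace N => y.2 ⟨0, Nat.zero_lt_of_lt hN⟩ := by fun_prop
  have hq0 : Continuous fun y : PhaseSpace N => y.1 ⟨0, Nat.zero_lt_of_lt hN⟩ := by fun_prop
  have hq1 : Continuous fun y : PhaseSpace N => y.1 ⟨1, hN⟩ := by fun_prop
  have hjm : Measurable ((pinnedChain ω₂ lam β γ).bondCurrent N ⟨0, Nat.zero_lt_of_lt hN⟩) :=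
    (pinnedChain_continuous_bondCurrent ω₂ lam β γ N _).measurable
  have hem : Measurable (fun y : PhaseSpace N => (y.2 ⟨0, Nat.zero_lt_of_lt hN⟩) ^ 2 / 2 +
      (pinnedChain ω₂ lam β γ).U (y.1 ⟨0, Nat.zero_lt_of_lt hN⟩) +
      (pinnedChain ω₂ lam β γ).V (y.1 ⟨1, hN⟩ - y.1 ⟨0, Nat.zero_lt_of_lt hN⟩) / 2) :=
    ((((hp0.pow 2).div_const 2).add (hUc.comp hq0)).add ((hVc.comp (hq1.sub hq0)).div_const 2)).measurable
  have hj2 := pinnedChain_integrable_sq_bondCurrent hω hl.le hβ.le γ N hT ⟨0, Nat.zero_lt_of_lt hN⟩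
  have he2 := pinnedChain_integrable_sq_siteEnergy hω hl.le hβ.le γ N hT hN
  have hQ2 := pinnedChain_integrable_heatProxy_sq hω hl hβ hγ hN hT hjm hem hj2 he2 ht
  -- the pathwise identity `A = (N−1)·Q + (G(z_t) − G(z_0))`
  have hpath : ∀ p : PhaseSpace N × WienerPair,
      (∫ s in (0 : ℝ)..t, (∑ i : Fin N, (pinnedChain ω₂ lam β γ).bondCurrent N i
        ((pinnedChain ω₂ lam β γ).solMap N T T s p.1 (pairPath p.2)))) =
      ((N : ℝ) - 1) * ((∫ s in (0 : ℝ)..t, (pinnedChain ω₂ lam β γ).bondCurrent N ⟨0, Nat.zero_lt_of_lt hN⟩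
          ((pinnedChain ω₂ lam β γ).solMap N T T s p.1 (pairPath p.2))) +
        (((((pinnedChain ω₂ lam β γ).solMap N T T t p.1 (pairPath p.2)).2 ⟨0, Nat.zero_lt_of_lt hN⟩) ^ 2 / 2 +
            (pinnedChain ω₂ lam β γ).U (((pinnedChain ω₂ lam β γ).solMap N T T t p.1 (pairPath p.2)).1 ⟨0, Nat.zero_lt_of_lt hN⟩) +
            (pinnedChain ω₂ lam β γ).V (((pinnedChain ω₂ lam β γ).solMap N T T t p.1 (pairPath p.2)).1 ⟨1, hN⟩ -
              ((pinnedChain ω₂ lam β γ).solMap N T T t p.1 (pairPath p.2)).1 ⟨0, Nat.zero_lt_of_lt hN⟩) / 2) -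
          ((p.1.2 ⟨0, Nat.zero_lt_of_lt hN⟩) ^ 2 / 2 + (pinnedChain ω₂ lam β γ).U (p.1.1 ⟨0, Nat.zero_lt_of_lt hN⟩) +
            (pinnedChain ω₂ lam β γ).V (p.1.1 ⟨1, hN⟩ - p.1.1 ⟨0, Nat.zero_lt_of_lt hN⟩) / 2))) +
      ((leftSpreadCentred (pinnedChain ω₂ lam β γ) T N 0 ((pinnedChain ω₂ lam β γ).solMap N T T t p.1 (pairPath p.2)) -
          ((N : ℝ) - 1) * (blockEnergyLeft (pinnedChain ω₂ lam β γ) N 0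
              ((pinnedChain ω₂ lam β γ).solMap N T T t p.1 (pairPath p.2)) -
            ∫ y', blockEnergyLeft (pinnedChain ω₂ lam β γ) N 0 y' ∂((pinnedChain ω₂ lam β γ).gibbsMeasure N T))) -
        (leftSpreadCentred (pinnedChain ω₂ lam β γ) T N 0 p.1 -
          ((N : ℝ) - 1) * (blockEnergyLeft (pinnedChain ω₂ lam β γ) N 0 p.1 -
            ∫ y', blockEnergyLeft (pinnedChain ω₂ lam β γ) N 0 y' ∂((pinnedChain ω₂ lam β γ).gibbsMeasure N T)))) := by
    intro p
    rw [pinnedChain_totalHeat_eq hω hl.le hβ.le hγ.le T T p.1 (pairPath p.2) ht hb, leftSpread_sub_eq _ T,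
      ← blockEnergyLeft_zero_eq (pinnedChain ω₂ lam β γ) hN ((pinnedChain ω₂ lam β γ).solMap N T T t p.1 (pairPath p.2)),
      ← blockEnergyLeft_zero_eq (pinnedChain ω₂ lam β γ) hN p.1]
    ring
  have hpath' : ∀ p : PhaseSpace N × WienerPair,
      ((N : ℝ) - 1) * ((∫ s in (0 : ℝ)..t, (pinnedChain ω₂ lam β γ).bondCurrent N ⟨0, Nat.zero_lt_of_lt hN⟩
          ((pinnedChain ω₂ lam β γ).solMap N T T s p.1 (pairPath p.2))) +
        (((((pinnedChain ω₂ lam β γ).solMap N T T t p.1 (pairPath p.2)).2 ⟨0, Nat.zero_lt_of_lt hN⟩) ^ 2 / 2 +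
            (pinnedChain ω₂ lam β γ).U (((pinnedChain ω₂ lam β γ).solMap N T T t p.1 (pairPath p.2)).1 ⟨0, Nat.zero_lt_of_lt hN⟩) +
            (pinnedChain ω₂ lam β γ).V (((pinnedChain ω₂ lam β γ).solMap N T T t p.1 (pairPath p.2)).1 ⟨1, hN⟩ -
              ((pinnedChain ω₂ lam β γ).solMap N T T t p.1 (pairPath p.2)).1 ⟨0, Nat.zero_lt_of_lt hN⟩) / 2) -
          ((p.1.2 ⟨0, Nat.zero_lt_of_lt hN⟩) ^ 2 / 2 + (pinnedChain ω₂ lam β γ).U (p.1.1 ⟨0, Nat.zero_lt_of_lt hN⟩) +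
            (pinnedChain ω₂ lam β γ).V (p.1.1 ⟨1, hN⟩ - p.1.1 ⟨0, Nat.zero_lt_of_lt hN⟩) / 2))) =
      1 * (∫ s in (0 : ℝ)..t, (∑ i : Fin N, (pinnedChain ω₂ lam β γ).bondCurrent N i
        ((pinnedChain ω₂ lam β γ).solMap N T T s p.1 (pairPath p.2)))) +
      ((leftSpreadCentred (pinnedChain ω₂ lam β γ) T N 0 p.1 -
          ((N : ℝ) - 1) * (blockEnergyLeft (pinnedChain ω₂ lam β γ) N 0 p.1 -
            ∫ y', blockEnergyLeft (pinnedChain ω₂ lam β γ) N 0 y' ∂((pinnedChain ω₂ lam β γ).gibbsMeasure N T))) -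
        (leftSpreadCentred (pinnedChain ω₂ lam β γ) T N 0 ((pinnedChain ω₂ lam β γ).solMap N T T t p.1 (pairPath p.2)) -
          ((N : ℝ) - 1) * (blockEnergyLeft (pinnedChain ω₂ lam β γ) N 0
              ((pinnedChain ω₂ lam β γ).solMap N T T t p.1 (pairPath p.2)) -
            ∫ y', blockEnergyLeft (pinnedChain ω₂ lam β γ) N 0 y' ∂((pinnedChain ω₂ lam β γ).gibbsMeasure N T)))) := by
    intro p
    rw [hpath p]
    ring
  -- the two splits
  have s1 := integral_sq_le_of_eq_mul_add_sub hpath hQ2 mGt.1 mG0.1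
  have s2 := integral_sq_le_of_eq_mul_add_sub hpath' hA2 mG0.1 mGt.1
  rw [← heatSpread_eq_integral_sq hω hl hβ hγ hT hN0 ht, pinnedChain_bathHeat_sq_eq hω hl hβ hγ hN hT ht, mGt.2,
    mG0.2] at s1
  rw [← heatSpread_eq_integral_sq hω hl hβ hγ hT hN0 ht, mGt.2, mG0.2] at s2
  have hcQ : ∫ p, (((N : ℝ) - 1) * ((∫ s in (0 : ℝ)..t, (pinnedChain ω₂ lam β γ).bondCurrent N ⟨0, Nat.zero_lt_of_lt hN⟩
          ((pinnedChain ω₂ lam β γ).solMap N T T s p.1 (pairPath p.2))) +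
        (((((pinnedChain ω₂ lam β γ).solMap N T T t p.1 (pairPath p.2)).2 ⟨0, Nat.zero_lt_of_lt hN⟩) ^ 2 / 2 +
            (pinnedChain ω₂ lam β γ).U (((pinnedChain ω₂ lam β γ).solMap N T T t p.1 (pairPath p.2)).1 ⟨0, Nat.zero_lt_of_lt hN⟩) +
            (pinnedChain ω₂ lam β γ).V (((pinnedChain ω₂ lam β γ).solMap N T T t p.1 (pairPath p.2)).1 ⟨1, hN⟩ -
              ((pinnedChain ω₂ lam β γ).solMap N T T t p.1 (pairPath p.2)).1 ⟨0, Nat.zero_lt_of_lt hN⟩) / 2) -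
          ((p.1.2 ⟨0, Nat.zero_lt_of_lt hN⟩) ^ 2 / 2 + (pinnedChain ω₂ lam β γ).U (p.1.1 ⟨0, Nat.zero_lt_of_lt hN⟩) +
            (pinnedChain ω₂ lam β γ).V (p.1.1 ⟨1, hN⟩ - p.1.1 ⟨0, Nat.zero_lt_of_lt hN⟩) / 2)))) ^ 2
      ∂(((pinnedChain ω₂ lam β γ).gibbsMeasure N T).prod wienerPair) =
      ((N : ℝ) - 1) ^ 2 * bathHeatVar ω₂ lam β γ T N t := by
    rw [← pinnedChain_bathHeat_sq_eq hω hl hβ hγ hN hT ht, ← MeasureTheory.integral_const_mul]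
    refine integral_congr_ae (Eventually.of_forall fun p => ?_)
    ring
  rw [hcQ] at s2
  constructor
  · nlinarith [hG2le]
  · nlinarith [hG2le]

end Transfer

end Summit.AtomisticToContinuum.FouriersLaw.Theorems.BoundedResponse.HeatSpreading

end
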